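import Summits.CriticalPhenomena.PercolationContinuityZ3.Theorems.Transplant.CdsNetCritical
import Summits.CriticalPhenomena.PercolationContinuityZ3.Theorems.Transplant.SqpNetCritical
import Summits.CriticalPhenomena.PercolationContinuityZ3.Theorems.Transplant.StatementPolynomialGrowth
import Summits.CriticalPhenomena.PercolationContinuityZ3.Theorems.Transplant.StatementBenjaminiSchramm
import Literature.Barriers.CriticalPhenomena.SubexponentialGrowthZdBurtonKeane
import Literature.Probability.LatticeModels.ThermodynamicLimit
import Mathlib.Tactic.FinCases
import HarnessLib

/-!
# SCOPE of the two pcu-derived nets (`cds` and the alternating-rung net): cubic growth, amenability, a.s. uniqueness of the infinite cluster,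
# connectedness of the alternating-rung net, and the place of both nets in Benjamini–Schramm's Conjecture 4 (its OPEN amenable residue)

builds on p205010 (kernel theorem, internal audit signed; external expert review pending) — nothing in this file uses p205010.
Lane `prim-bschramm`, seat `prim-bschramm-p2` (gen 11; class C1b); helper file (`--supports stmt-CriticalPhenomena-4575 --as helper`); PROOFS ONLY
(pattern = `Z3TallGensScope` / p1-g12's `Z3UnitGensScope`).  Memo: `HOME/bschramm/P2-LATTICES.md` §33–§35.
Both nets live on `ℤ³` and every bond moves every coordinate by at most one, so balls sit in cubes: `|B(x,n)| ≤ (2n+1)³`; hence no exponential growth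
(outside Hutchcroft 2016), amenable (Lyons–Peres §6.1 contrapositive for quasi-transitive graphs), a.s. at most one infinite cluster at every density
(Burton–Keane, tree), and each net satisfies every hypothesis of Conjecture 4 while lying in its open amenable-subexponential residue.
* §1 generic: `ballVolume_le_of_coord_lipschitz` (any graph on `ℤ³` whose bonds move coordinates by `≤ 1`);
* §2 `Cds.*`: `abs_sub_le_of_adj`, `ballVolume_le`, `not_hasExponentialGrowth`, `isGraphAmenable`, `numInfiniteClusters_le_one`, `in_scope`,
  `criticalContinuity_of_conj4_amenableSubexponential` (the net is a customer of the OPEN residue — and a theorem regardless, `Cds.criticalContinuity`);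
* §3 `Sqp.*`: the same list, plus **`Sqp.graph_connected`** and `Sqp.conj4_hypotheses`.
[cite: BenjaminiSchramm1996, §2 and Conj. 4] [cite: LyonsPeres2016, §6.1, Thm. 7.6] [cite: BurtonKeane1989, Thm. 2] [cite: Hutchcroft2016, Thm. 1]
-/

noncomputable section

namespace Summit.CriticalPhenomena.PercolationContinuityZ3.Theorems.Transplant

open MeasureTheory Filter Literature.Probability.Percolation Literature.Probability.LatticeModels SimpleGraph
open Literature.Barriers.CriticalPhenomena (IsQuasiTransitive IsGraphTransitive IsGraphAmenable HasExponentialGrowth graphBall ballVolume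
  hasExponentialGrowth_of_not_isGraphAmenable eventually_pow_lt_const_pow BurtonKeane1989_atMostOneInfiniteCluster_holds)
open scoped Classical

/-! ## §1 Generic: coordinate-Lipschitz graphs on `ℤ³` have cubic growth -/

/-- Along a walk of length `n` in a graph on `ℤ³` whose bonds move every coordinate by at most one, every coordinate moves by at most `n`. [folklore] -/
theorem abs_sub_le_length_of_coord_lipschitz (G : SimpleGraph (Site 3)) (hG : ∀ ⦃x y : Site 3⦄, G.Adj x y → ∀ i : Fin 3, |x i - y i| ≤ 1)
    {x y : Site 3} (w : G.Walk x y) (i : Fin 3) : |y i - x i| ≤ (w.length : ℤ) := by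
  induction w with
  | nil => simp
  | @cons a b c hab w ih =>
    have h1 : |b i - a i| ≤ 1 := by rw [abs_sub_comm]; exact hG hab i
    have h2 : |c i - a i| ≤ |c i - b i| + |b i - a i| := by
      have := abs_sub_le (c i) (b i) (a i); linarith
    simp only [SimpleGraph.Walk.length_cons, Nat.cast_add, Nat.cast_one]
    linarith

/-- **Cubic growth `|B(x,n)| ≤ (2n+1)³`** for every graph on `ℤ³` whose bonds move every coordinate by at most one. [cite: LyonsPeres2016, §6.1] -/
theorem ballVolume_le_of_coord_lipschitz (G : SimpleGraph (Site 3)) (hG : ∀ ⦃x y : Site 3⦄, G.Adj x y → ∀ i : Fin 3, |x i - y i| ≤ 1)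
    (x : Site 3) (n : ℕ) : ballVolume G x n ≤ (2 * n + 1) ^ 3 := by
  set f : Site 3 → Site 3 := fun y => y - x with hf
  have hinj : Function.Injective f := fun y z h => sub_left_injective h
  have hsub : f '' graphBall G x n ⊆ (↑(box 3 n) : Set (Site 3)) := by
    rintro _ ⟨y, ⟨w, hw⟩, rfl⟩
    rw [Finset.mem_coe, mem_box]
    intro i
    have h := abs_sub_le_length_of_coord_lipschitz G hG w i
    have hn : (w.length : ℤ) ≤ n := by exact_mod_cast hw
    simp only [hf, Pi.sub_apply]
    constructor <;> linarith [(abs_le.1 (h.trans hn)).1, (abs_le.1 (h.trans hn)).2]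
  unfold ballVolume
  rw [← Set.ncard_image_of_injective _ hinj, ← card_box 3 n, ← Set.ncard_coe_finset]
  exact Set.ncard_le_ncard hsub (box 3 n).finite_toSet

/-- No exponential growth under cubic growth. [cite: Hutchcroft2016, Thm. 1] -/
theorem not_hasExponentialGrowth_of_coord_lipschitz (G : SimpleGraph (Site 3))
    (hG : ∀ ⦃x y : Site 3⦄, G.Adj x y → ∀ i : Fin 3, |x i - y i| ≤ 1) : ¬ HasExponentialGrowth G := by
  intro h
  obtain ⟨c, hc, hev⟩ := h (0 : Site 3)
  obtain ⟨n, hn1, hn2⟩ := (hev.and (eventually_pow_lt_const_pow 3 hc)).exists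
  have hvol : (ballVolume G (0 : Site 3) n : ℝ) ≤ (2 * n + 1) ^ 3 := by exact_mod_cast ballVolume_le_of_coord_lipschitz G hG _ n
  linarith

/-! ## §2 The `cds` net -/

namespace Cds

/-- Every bond of the `cds` net moves every coordinate by at most one. [folklore] -/
theorem abs_sub_le_of_adj {x y : Site 3} (h : Cds.graph.Adj x y) (i : Fin 3) : |x i - y i| ≤ 1 := by
  rw [graph_adj_iff'] at h
  have h0 : ∀ j : Fin 3, |Z3Diag.ev (hdir x) j| ≤ 1 := fun j => by
    by_cases hx : Even (x 2)
    · rw [hdir_of_even hx]; fin_cases j <;> simp [Z3Diag.ev]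
    · rw [hdir_of_not_even hx]; fin_cases j <;> simp [Z3Diag.ev]
  rcases h with rfl | rfl | rfl | rfl
  · simpa using h0 i
  · simpa using h0 i
  · fin_cases i <;> simp [Z3Diag.ev]
  · fin_cases i <;> simp [Z3Diag.ev]

/-- **Cubic growth of the `cds` net.** [cite: LyonsPeres2016, §6.1] -/
theorem ballVolume_le (x : Site 3) (n : ℕ) : ballVolume Cds.graph x n ≤ (2 * n + 1) ^ 3 :=
  ballVolume_le_of_coord_lipschitz Cds.graph (fun _ _ h => abs_sub_le_of_adj h) x n

/-- The `cds` net has no exponential growth (outside Hutchcroft's theorem). [cite: Hutchcroft2016, Thm. 1] -/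
theorem not_hasExponentialGrowth : ¬ HasExponentialGrowth Cds.graph :=
  not_hasExponentialGrowth_of_coord_lipschitz Cds.graph fun _ _ h => abs_sub_le_of_adj h

/-- **The `cds` net is amenable.** [cite: LyonsPeres2016, §6.1 (p. 279)] -/
theorem isGraphAmenable : IsGraphAmenable Cds.graph := by
  by_contra h
  exact not_hasExponentialGrowth (hasExponentialGrowth_of_not_isGraphAmenable _ graph_quasiTransitive h)

/-- **A.s. uniqueness of the infinite cluster on the `cds` net at every density** (Burton–Keane). [cite: BurtonKeane1989, Thm. 2] [cite: LyonsPeres2016, Thm. 7.6] -/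
theorem numInfiniteClusters_le_one (p : unitInterval) : ∀ᵐ ω ∂(bondPercolation Cds.graph p), numInfiniteClusters ω ≤ 1 :=
  BurtonKeane1989_atMostOneInfiniteCluster_holds _ graph_connected graph_quasiTransitive isGraphAmenable p

/-- **The `cds` net is in scope of Conjecture 4**: connected, vertex-transitive, cubic growth, no exponential growth, amenable, a.s. uniqueness at every
`p`, `0 ≤ p_c < 1`. [cite: BenjaminiSchramm1996, Conj. 4 and §2] -/
theorem in_scope :
    Cds.graph.Connected ∧ IsGraphTransitive Cds.graph ∧ (∀ (x : Site 3) (n : ℕ), ballVolume Cds.graph x n ≤ (2 * n + 1) ^ 3) ∧ ¬ HasExponentialGrowth Cds.graph ∧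
      IsGraphAmenable Cds.graph ∧ (∀ p : unitInterval, ∀ᵐ ω ∂(bondPercolation Cds.graph p), numInfiniteClusters ω ≤ 1) ∧
      0 ≤ criticalProb Cds.graph (0 : Site 3) ∧ criticalProb Cds.graph (0 : Site 3) < 1 :=
  ⟨graph_connected, graph_transitive, ballVolume_le, not_hasExponentialGrowth, isGraphAmenable, numInfiniteClusters_le_one,
    (criticalProb_mem_Icc Cds.graph (0 : Site 3)).1, criticalProb_lt_one⟩

/-- The OPEN amenable-subexponential residue of Conjecture 4 implies the `cds` headline (which is a theorem regardless: `Cds.criticalContinuity`) — i.e. the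
net lies in the residue's class, not in Hutchcroft's or BLPS's. [cite: BenjaminiSchramm1996, Conj. 4] [cite: Hutchcroft2016, Thm. 1] -/
theorem criticalContinuity_of_conj4_amenableSubexponential (h : BenjaminiSchramm1996_conj4_amenableSubexponential) (v : Site 3) :
    theta Cds.graph v (criticalProbIOf Cds.graph v) = 0 :=
  h Cds.graph graph_connected graph_quasiTransitive isGraphAmenable not_hasExponentialGrowth v (criticalProb_lt_one' v)

end Cds

/-! ## §3 The alternating-rung net -/

namespace Sqp

/-- Every bond of the alternating-rung net moves every coordinate by at most one. [folklore] -/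
theorem abs_sub_le_of_adj {x y : Site 3} (h : Sqp.graph.Adj x y) (i : Fin 3) : |x i - y i| ≤ 1 := by
  rw [graph_adj_iff'] at h
  rcases h with rfl | rfl | rfl | rfl | rfl
  · fin_cases i <;> simp [Z3Diag.ev]
  · fin_cases i <;> simp [Z3Diag.ev]
  · fin_cases i <;> simp [Z3Diag.ev]
  · fin_cases i <;> simp [Z3Diag.ev]
  · by_cases hx : Even (psum x)
    · rw [rung_of_even hx]; fin_cases i <;> simp [Z3Diag.ev]
    · rw [rung_of_not_even hx]; fin_cases i <;> simp [Z3Diag.ev]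

/-- **The alternating-rung net is connected** (every vertex lies in some cylinder about `0`). [folklore] -/
theorem graph_connected : Sqp.graph.Connected := by
  haveI : Nonempty (Site 3) := ⟨0⟩
  refine ⟨fun x y => ?_⟩
  have key : ∀ w : Site 3, Sqp.graph.Reachable w 0 := by
    intro w
    set ℓ : ℕ := max (max (w 1).natAbs (w 2).natAbs) 1 with hℓ
    have hw : w ∈ cyl ℓ := by rw [mem_cyl_iff, abs_le, abs_le]; omega
    exact (cyl_reachable_zero (le_max_right _ _) w hw).map (SimpleGraph.Embedding.induce _).toHom
  exact (key x).trans (key y).symm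

/-- **Cubic growth of the alternating-rung net.** [cite: LyonsPeres2016, §6.1] -/
theorem ballVolume_le (x : Site 3) (n : ℕ) : ballVolume Sqp.graph x n ≤ (2 * n + 1) ^ 3 :=
  ballVolume_le_of_coord_lipschitz Sqp.graph (fun _ _ h => abs_sub_le_of_adj h) x n

/-- The alternating-rung net has no exponential growth. [cite: Hutchcroft2016, Thm. 1] -/
theorem not_hasExponentialGrowth : ¬ HasExponentialGrowth Sqp.graph :=
  not_hasExponentialGrowth_of_coord_lipschitz Sqp.graph fun _ _ h => abs_sub_le_of_adj h

/-- **The alternating-rung net is amenable.** [cite: LyonsPeres2016, §6.1 (p. 279)] -/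
theorem isGraphAmenable : IsGraphAmenable Sqp.graph := by
  by_contra h
  exact not_hasExponentialGrowth (hasExponentialGrowth_of_not_isGraphAmenable _ graph_quasiTransitive h)

/-- **A.s. uniqueness of the infinite cluster on the alternating-rung net at every density.** [cite: BurtonKeane1989, Thm. 2] [cite: LyonsPeres2016, Thm. 7.6] -/
theorem numInfiniteClusters_le_one (p : unitInterval) : ∀ᵐ ω ∂(bondPercolation Sqp.graph p), numInfiniteClusters ω ≤ 1 :=
  BurtonKeane1989_atMostOneInfiniteCluster_holds _ graph_connected graph_quasiTransitive isGraphAmenable p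

/-- `p_c < 1` at every vertex of the alternating-rung net. [folklore] -/
theorem criticalProb_lt_one' (v : Site 3) : criticalProb Sqp.graph v < 1 := by
  obtain ⟨γ, hγ⟩ := exists_iso_apply_zero v
  have hpc := criticalProb_iso γ (0 : Site 3)
  rw [hγ] at hpc
  rw [hpc]; exact criticalProb_lt_one

/-- **Scope record of the alternating-rung net**: connected, vertex-transitive, quasi-transitive, cubic growth, amenable, a.s. uniqueness, `0 ≤ p_c < 1`,
one skeleton type, cylinders subcritical at every `p < 1`. [cite: BenjaminiSchramm1996, Conj. 4 and §2] -/
theorem conj4_hypotheses :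
    Sqp.graph.Connected ∧ IsGraphTransitive Sqp.graph ∧ IsQuasiTransitive Sqp.graph ∧ (∀ (x : Site 3) (n : ℕ), ballVolume Sqp.graph x n ≤ (2 * n + 1) ^ 3) ∧
      IsGraphAmenable Sqp.graph ∧ (∀ p : unitInterval, ∀ᵐ ω ∂(bondPercolation Sqp.graph p), numInfiniteClusters ω ≤ 1) ∧
      0 ≤ criticalProb Sqp.graph (0 : Site 3) ∧ criticalProb Sqp.graph (0 : Site 3) < 1 ∧
      skeletonSign.types = {0} ∧ ∀ p : unitInterval, (p : ℝ) < 1 → skeletonSign.CylSubcritical p :=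
  ⟨graph_connected, graph_transitive, graph_quasiTransitive, ballVolume_le, isGraphAmenable, numInfiniteClusters_le_one,
    (criticalProb_mem_Icc Sqp.graph (0 : Site 3)).1, criticalProb_lt_one, skeletonSign_types, skeletonSign_cylSubcritical⟩

/-- The OPEN amenable-subexponential residue of Conjecture 4 implies the headline (a theorem regardless: `Sqp.criticalContinuity`).
[cite: BenjaminiSchramm1996, Conj. 4] [cite: Hutchcroft2016, Thm. 1] -/
theorem criticalContinuity_of_conj4_amenableSubexponential (h : BenjaminiSchramm1996_conj4_amenableSubexponential) (v : Site 3) :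
    theta Sqp.graph v (criticalProbIOf Sqp.graph v) = 0 :=
  h Sqp.graph graph_connected graph_quasiTransitive isGraphAmenable not_hasExponentialGrowth v (criticalProb_lt_one' v)

end Sqp

end Summit.CriticalPhenomena.PercolationContinuityZ3.Theorems.Transplant

end
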